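import Summits.CriticalPhenomena.PercolationContinuityZ3.Theorems.PercNearOneGluingNoHeavyLowerTailUpsetExchange
import Summits.CriticalPhenomena.PercolationContinuityZ3.Theorems.PercNearOneGluingAdditiveGluingSigmaRecursion
import Summits.CriticalPhenomena.PercolationContinuityZ3.Theorems.PercNearOneGluingAdditiveGluingSigmaLaw
import Summits.CriticalPhenomena.PercolationContinuityZ3.Theorems.PercNearOneGluingAdditiveGluingSigmaGeometry
import Summits.CriticalPhenomena.PercolationContinuityZ3.Theorems.PercNearOneGluingAdditiveGluingGluingLemma5
import HarnessLib

/-!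
# `NoHeavyLowerTail` (stmt-CriticalPhenomena-4575) — Kozma–Nitzan Question 9 for a glued one-layer block:
# Theorem 4 (witness, (41)-form) for blocks, and the case of AT MOST ONE dangerous port

Support file (hull-port / coupling seat `prim-hp-1` gen 7; `--supports stmt-CriticalPhenomena-4575`).
No definitions, no named facts, no sorries.

Setting (`Fin n`, weights `w`): a block `O` disjoint from the relay set `A`, ONE-LAYER (every positive pair
leaving `O` ends in `A`) and with no positive pair inside; `μ_{glue_O w}` is percolation with `O` contracted,
`μ_{kill_O w}` percolation with `O` deleted.  A PORT is a relay receiving a positive pair from `O`.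

* `blockThm4_witness` — **Kozma–Nitzan's Theorem 4 for a glued one-layer block, (41)-form with the witness
  exposed**: if `a ∉ O` is at most as connected to `b` as every port in the block-DELETED graph `kill_O w`, then
  `μ_{glue_O w}(a ↔ b, O ↔ A) ≤ μ_{glue_O w}(O ↔ b)`.  (Layers of the σ-recursion engine `stub_sigmaLaw`,
  `stub_sigmaGeometry`, and `stub_gluingLemma5` per layer; no internal positive pair is needed here but the
  one-layer hypothesis is.)
* `blockQ9_oneDangerousPort` — **Question 9 for the block when at most one port is dangerous**: if the ports other
  than `v` dominate `a` in `kill_O w` as above, `v` is attached to `O` through a single pair `s(s₀, v)`, and `a` is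
  at most as connected to `b` as `v` in the UNGLUED graph `w` (the members of `O` present as separate vertices),
  then again `μ_{glue_O w}(a ↔ b, O ↔ A) ≤ μ_{glue_O w}(O ↔ b)`.  Proof: on `{s(s₀,v) open}` the up-set exchange
  lemma (`UpsetExchange.upsetExchange_block`, this seat); on `{s(s₀,v) closed}` the pair is deleted
  (`UpsetExchange.killSet_pushforward` + independence) and `blockThm4_witness` applies to the remaining ports.

Context (memo HULLPORT-COUPLING.md §48): for `O = {o} ∪ hubs` of a depth-two observer with `w` = the graph with the
edges at `o` deleted, `a = argmin_A μ_w(· ↔ b)` is Kozma–Nitzan's Question-9 relay; numerically the conclusion holds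
with any number of dangerous ports (0 violations in ~2·10⁵ exact evaluations); `≤ 1` is what is proved here.
-/

namespace Summit.CriticalPhenomena.PercolationContinuityZ3.Theorems

open MeasureTheory Set ProbabilityTheory
open Literature.Probability.LatticeModels
open Literature.Probability.Percolation

noncomputable section
open Classical

namespace BlockQ9

variable {n : ℕ}

/-- **Theorem 4 for a glued one-layer block, (41)-form, witness exposed.**  `O` disjoint from `A`, one-layer
(`w s(x,y) = 0` for `x ∈ O`, `y ∉ O ∪ A`); `a, b ∉ O`; `a` dominated in `kill_O w` by every port.  Then
`μ_{glue_O w}(a ↔ b, O ↔ A) ≤ μ_{glue_O w}(O ↔ b)`. [cite: KozmaNitzan2024, Thm. 4 and Lemma 5 (pp. 12–14)] -/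
theorem blockThm4_witness (w : Sym2 (Fin n) → unitInterval) (O A : Finset (Fin n)) (a b : Fin n)
    (hOA : Disjoint O A) (haO : a ∉ O) (hbO : b ∉ O)
    (hiso : ∀ x ∈ O, ∀ y : Fin n, y ∉ O → y ∉ A → w s(x, y) = 0)
    (hdom : ∀ v ∈ A, (∃ o ∈ O, w s(o, v) ≠ 0) →
      (prodBernoulli (fun e : Sym2 (Fin n) => if (∃ x ∈ e, x ∈ O) then 0 else w e)).real (openConn a b) ≤
        (prodBernoulli (fun e : Sym2 (Fin n) => if (∃ x ∈ e, x ∈ O) then 0 else w e)).real (openConn v b)) :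
    (prodBernoulli (fun e : Sym2 (Fin n) => if (∀ x ∈ e, x ∈ O) ∧ ¬ e.IsDiag then 1 else w e)).real
        (openConn a b ∩ ⋃ o ∈ O, ⋃ x ∈ A, openConn o x) ≤
      (prodBernoulli (fun e : Sym2 (Fin n) => if (∀ x ∈ e, x ∈ O) ∧ ¬ e.IsDiag then 1 else w e)).real
        (⋃ o ∈ O, openConn o b) := by
  classical
  set g : Sym2 (Fin n) → unitInterval := fun e => if (∀ x ∈ e, x ∈ O) ∧ ¬ e.IsDiag then 1 else w e with hg
  set k : Sym2 (Fin n) → unitInterval := fun e => if (∃ x ∈ e, x ∈ O) then 0 else w e with hk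
  -- layer decomposition of both sides
  rw [sigmaRec_partition g O (openConn a b ∩ _), sigmaRec_partition g O (⋃ o ∈ O, openConn o b)]
  refine Finset.sum_le_sum fun S _ => ?_
  set L : Set (BondConfig (Fin n)) := {ω | ∀ x : Fin n, x ∈ S ↔ (x ∉ O ∧ ∃ o ∈ O, s(o, x) ∈ ω)} with hL
  set Ψ : BondConfig (Fin n) → BondConfig (Fin n) := fun ω =>
    ({e | e ∈ ω ∧ ∀ x ∈ e, x ∉ O} ∪ {e | (∀ x ∈ e, x ∈ S) ∧ ¬ e.IsDiag} : BondConfig (Fin n)) with hΨ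
  set gS : Sym2 (Fin n) → unitInterval := fun e =>
    if (∀ x ∈ e, x ∈ S) ∧ ¬ e.IsDiag then 1 else if (∃ x ∈ e, x ∈ O) then 0 else w e with hgS
  -- internal pairs of `O` are a.s. open under the glued weights
  set K : Set (BondConfig (Fin n)) := {ω | ∀ o ∈ O, ∀ o' ∈ O, o ≠ o' → s(o, o') ∈ ω} with hK
  have hKc : prodBernoulli g Kᶜ = 0 := by
    refine sigmaRec_conull g K fun ω hω => ?_
    simp only [hK, mem_setOf_eq, not_forall] at hω
    obtain ⟨o, ho, o', ho', hne, hclosed⟩ := hω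
    refine ⟨s(o, o'), ?_, hclosed⟩
    simp only [hg]
    rw [if_pos ⟨fun x hx => by rcases Sym2.mem_iff.1 hx with rfl | rfl <;> assumption,
      by rw [Sym2.mk_isDiag_iff]; exact hne⟩]
  -- geometry on `L ∩ K`
  have hgeomA : ∀ ω, ω ∈ L → ω ∈ K →
      (ω ∈ (openConn a b ∩ ⋃ o ∈ O, ⋃ x ∈ A, openConn o x : Set (BondConfig (Fin n))) ↔
        ω ∈ Ψ ⁻¹' (openConn a b ∩ ⋃ s ∈ S, ⋃ x ∈ A, openConn s x)) := by
    intro ω hωL hωK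
    obtain ⟨h1, h2⟩ := stub_sigmaGeometry n O S ω hωL hωK
    simp only [mem_preimage, mem_inter_iff]
    exact and_congr (h2 a b haO hbO) (h1 A hOA)
  have hgeomB : ∀ ω, ω ∈ L → ω ∈ K →
      (ω ∈ (⋃ o ∈ O, openConn o b : Set (BondConfig (Fin n))) ↔ ω ∈ Ψ ⁻¹' (⋃ s ∈ S, openConn s b)) := by
    intro ω hωL hωK
    obtain ⟨h1, -⟩ := stub_sigmaGeometry n O S ω hωL hωK
    have hOb : Disjoint O {b} := Finset.disjoint_singleton_right.2 hbO
    have := h1 {b} hOb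
    simp only [Finset.mem_singleton, iUnion_iUnion_eq_left] at this
    simpa only [mem_preimage] using this
  -- null layers: some `x ∈ S` receives no positive pair from `O` (in particular `x ∈ O` or `x ∉ A`)
  by_cases hgen : ∀ x ∈ S, x ∉ O ∧ ∃ o ∈ O, w s(o, x) ≠ 0
  swap
  · have hL0 : (prodBernoulli g).real L = 0 := by
      push Not at hgen
      obtain ⟨x, hxS, hx⟩ := hgen
      by_cases hxO : x ∈ O
      · have hLe : L = ∅ := by
          ext ω
          simp only [hL, mem_setOf_eq, mem_empty_iff_false, iff_false]
          intro h
          exact ((h x).1 hxS).1 hxO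
        rw [hLe, measureReal_empty]
      · refine sigmaRec_null g L (O.image fun o => s(o, x)) (fun e he => ?_) (fun ω hω => ?_)
        · obtain ⟨o, ho, rfl⟩ := Finset.mem_image.1 he
          have hw0 : w s(o, x) = 0 := hx hxO o ho
          have hnot : ¬ ((∀ y ∈ s(o, x), y ∈ O) ∧ ¬ (s(o, x)).IsDiag) := fun h =>
            hxO (h.1 x (Sym2.mem_mk_right o x))
          simp only [hg]
          rw [if_neg hnot, hw0]
        · obtain ⟨-, o, ho, hox⟩ := ((hω : ω ∈ L) x |>.1) hxS
          exact ⟨s(o, x), Finset.mem_image.2 ⟨o, ho, rfl⟩, hox⟩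
    calc (prodBernoulli g).real (L ∩ (openConn a b ∩ ⋃ o ∈ O, ⋃ x ∈ A, openConn o x))
        ≤ (prodBernoulli g).real L := measureReal_mono inter_subset_left
      _ = 0 := hL0
      _ ≤ _ := measureReal_nonneg
  rw [sigmaRec_inter_congr g hKc hgeomA, sigmaRec_inter_congr g hKc hgeomB]
  -- the empty layer: `O` is isolated, the left event is empty
  rcases S.eq_empty_or_nonempty with hSe | hSne
  · have h0 : Ψ ⁻¹' (openConn a b ∩ ⋃ s ∈ S, ⋃ x ∈ A, (openConn s x : Set (BondConfig (Fin n)))) = ∅ := by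
      rw [hSe]; ext ω; simp
    rw [h0, inter_empty, measureReal_empty]
    exact measureReal_nonneg
  -- the layer law
  have hlawA := stub_sigmaLaw n w O S (openConn a b ∩ ⋃ s ∈ S, ⋃ x ∈ A, openConn s x)
  have hlawB := stub_sigmaLaw n w O S (⋃ s ∈ S, openConn s b)
  change (prodBernoulli g).real (L ∩ Ψ ⁻¹' _) = (prodBernoulli g).real L * (prodBernoulli gS).real _ at hlawA
  change (prodBernoulli g).real (L ∩ Ψ ⁻¹' _) = (prodBernoulli g).real L * (prodBernoulli gS).real _ at hlawB
  rw [hlawA, hlawB]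
  refine mul_le_mul_of_nonneg_left ?_ measureReal_nonneg
  -- the layer inequality in the world `glue_S (kill_O w)`
  by_cases hbS : b ∈ S
  · have h1 : (prodBernoulli gS).real (⋃ s ∈ S, openConn s b) = 1 := by
      have : (⋃ s ∈ S, openConn s b : Set (BondConfig (Fin n))) = univ :=
        eq_univ_of_forall fun ω => mem_iUnion₂.2
          ⟨b, hbS, (SimpleGraph.Reachable.refl b : (openGraph ω).Reachable b b)⟩
      rw [this, probReal_univ]
    rw [h1]; exact measureReal_le_one
  obtain ⟨v, hvS⟩ := hSne
  obtain ⟨hvO, hport⟩ := hgen v hvS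
  have hvA : v ∈ A := by
    by_contra hvA
    obtain ⟨o, ho, hw⟩ := hport
    exact hw (hiso o ho v hvO hvA)
  have h5 := stub_gluingLemma5 n k S a v b hvS hbS (hdom v hvA hport)
  exact (measureReal_mono inter_subset_left).trans h5

/-- Deleting one pair `e` by conditioning it closed: `μ_u(Y ∩ {e ∉ ω}) = (1 − u e) · μ_{u'}(Y)` where `u'` agrees with
`u` off `e` and `u' e = 0`. [folklore; Grimmett 1999 §1.3, §2.2] -/
theorem real_inter_notMem_eq (u u' : Sym2 (Fin n) → unitInterval) (e : Sym2 (Fin n))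
    (h1 : u' e = 0) (h2 : ∀ f, f ≠ e → u f = u' f) (Y : Set (BondConfig (Fin n))) :
    (prodBernoulli u).real (Y ∩ {ω | e ∉ ω}) = (1 - (u e : ℝ)) * (prodBernoulli u').real Y := by
  classical
  have hset : Y ∩ {ω : BondConfig (Fin n) | e ∉ ω} =
      {ω : BondConfig (Fin n) | e ∉ ω} ∩ {ω | ((ω \ {e} : Set (Sym2 (Fin n))) : BondConfig (Fin n)) ∈ Y} := by
    ext ω
    simp only [mem_inter_iff, mem_setOf_eq]
    constructor
    · rintro ⟨hY, he⟩
      have : (ω \ {e} : Set (Sym2 (Fin n))) = ω := by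
        ext f; simp only [Set.mem_sdiff, mem_singleton_iff, and_iff_left_iff_imp]; rintro hf rfl; exact he hf
      refine ⟨he, ?_⟩
      show ((ω \ {e} : Set (Sym2 (Fin n))) : BondConfig (Fin n)) ∈ Y
      rw [this]; exact hY
    · rintro ⟨he, hY⟩
      have : (ω \ {e} : Set (Sym2 (Fin n))) = ω := by
        ext f; simp only [Set.mem_sdiff, mem_singleton_iff, and_iff_left_iff_imp]; rintro hf rfl; exact he hf
      rw [this] at hY
      exact ⟨hY, he⟩
  have hA : DeterminedBy {ω : BondConfig (Fin n) | e ∉ ω} (↑({e} : Finset (Sym2 (Fin n))) : Set (Sym2 (Fin n))) := by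
    rw [determinedBy_iff]
    intro ω ω' hωω'
    have := Set.ext_iff.1 hωω' e
    simp only [Finset.coe_singleton, mem_inter_iff, mem_singleton_iff, and_true] at this
    simp only [mem_setOf_eq, this]
  have hB : DeterminedBy {ω : BondConfig (Fin n) | ((ω \ {e} : Set (Sym2 (Fin n))) : BondConfig (Fin n)) ∈ Y}
      (↑({e} : Finset (Sym2 (Fin n))) : Set (Sym2 (Fin n)))ᶜ := by
    rw [determinedBy_iff]
    intro ω ω' hωω'
    simp only [mem_setOf_eq]
    suffices h : (ω \ {e} : Set (Sym2 (Fin n))) = ω' \ {e} by rw [h]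
    ext f
    by_cases hf : f = e
    · simp [hf]
    · have := Set.ext_iff.1 hωω' f
      simp only [Finset.coe_singleton, mem_inter_iff, mem_compl_iff, mem_singleton_iff, hf, not_false_eq_true,
        and_true] at this
      simp [Set.mem_sdiff, hf, this]
  rw [hset, prodBernoulli_real_inter_of_determinedBy u {e} hA hB MeasurableSet.of_discrete MeasurableSet.of_discrete,
    prodBernoulli_real_setOf_notMem,
    UpsetExchange.killSet_pushforward u' u ({e} : Set (Sym2 (Fin n))) (fun f hf => by
      rw [mem_singleton_iff.1 hf]; exact h1) (fun f hf => h2 f (fun h => hf (mem_singleton_iff.2 h))) Y]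

/-- **Question 9 for a glued one-layer block with at most one dangerous port.**  `O` disjoint from `A`, one-layer,
with no positive pair inside; `a, b ∉ O`; the port `v ∉ O` is attached to `O` through the single pair `s(s₀, v)`
(`s₀ ∈ O`); every OTHER port dominates `a` in the block-deleted graph `kill_O w`; and `a` is at most as connected
to `b` as `v` in the UNGLUED graph `w`.  Then `μ_{glue_O w}(a ↔ b, O ↔ A) ≤ μ_{glue_O w}(O ↔ b)`.
[cite: KozmaNitzan2024, Thm. 4, Lemma 5, Question 9 (pp. 12–14, 36)] -/
theorem blockQ9_oneDangerousPort (w : Sym2 (Fin n) → unitInterval) (O A : Finset (Fin n)) (a b v s₀ : Fin n)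
    (hOA : Disjoint O A) (haO : a ∉ O) (hbO : b ∉ O) (hvO : v ∉ O) (hs₀ : s₀ ∈ O)
    (hiso : ∀ x ∈ O, ∀ y : Fin n, y ∉ O → y ∉ A → w s(x, y) = 0)
    (hO0 : ∀ e : Sym2 (Fin n), (∀ x ∈ e, x ∈ O) → ¬ e.IsDiag → w e = 0)
    (hv1 : ∀ o ∈ O, o ≠ s₀ → w s(o, v) = 0)
    (hdom : ∀ p ∈ A, p ≠ v → (∃ o ∈ O, w s(o, p) ≠ 0) →
      (prodBernoulli (fun e : Sym2 (Fin n) => if (∃ x ∈ e, x ∈ O) then 0 else w e)).real (openConn a b) ≤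
        (prodBernoulli (fun e : Sym2 (Fin n) => if (∃ x ∈ e, x ∈ O) then 0 else w e)).real (openConn p b))
    (hyp : (prodBernoulli w).real (openConn a b) ≤ (prodBernoulli w).real (openConn v b)) :
    (prodBernoulli (fun e : Sym2 (Fin n) => if (∀ x ∈ e, x ∈ O) ∧ ¬ e.IsDiag then 1 else w e)).real
        (openConn a b ∩ ⋃ o ∈ O, ⋃ x ∈ A, openConn o x) ≤
      (prodBernoulli (fun e : Sym2 (Fin n) => if (∀ x ∈ e, x ∈ O) ∧ ¬ e.IsDiag then 1 else w e)).real
        (⋃ o ∈ O, openConn o b) := by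
  classical
  set g : Sym2 (Fin n) → unitInterval := fun e => if (∀ x ∈ e, x ∈ O) ∧ ¬ e.IsDiag then 1 else w e with hg
  set e₀ : Sym2 (Fin n) := s(s₀, v) with he₀
  have hsv : s₀ ≠ v := fun h => hvO (h ▸ hs₀)
  have he₀int : ¬ ((∀ x ∈ e₀, x ∈ O) ∧ ¬ e₀.IsDiag) := fun h => hvO (h.1 v (Sym2.mem_mk_right s₀ v))
  -- the weights with `e₀` deleted, and their glue / kill
  set w' : Sym2 (Fin n) → unitInterval := fun f => if f = e₀ then 0 else w f with hw'
  set g' : Sym2 (Fin n) → unitInterval := fun e => if (∀ x ∈ e, x ∈ O) ∧ ¬ e.IsDiag then 1 else w' e with hg'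
  have hkill : (fun e : Sym2 (Fin n) => if (∃ x ∈ e, x ∈ O) then (0 : unitInterval) else w' e) =
      fun e : Sym2 (Fin n) => if (∃ x ∈ e, x ∈ O) then 0 else w e := by
    funext f
    by_cases hf : ∃ x ∈ f, x ∈ O
    · rw [if_pos hf, if_pos hf]
    · rw [if_neg hf, if_neg hf]
      have : f ≠ e₀ := fun h => hf ⟨s₀, h ▸ Sym2.mem_mk_left s₀ v, hs₀⟩
      simp only [hw', if_neg this]
  -- splitting both sides along `e₀`
  set U : Set (BondConfig (Fin n)) := ⋃ o ∈ O, ⋃ x ∈ A, openConn o x with hU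
  have hsplit : ∀ X : Set (BondConfig (Fin n)), (prodBernoulli g).real X =
      (prodBernoulli g).real (X ∩ {ω | e₀ ∈ ω}) + (prodBernoulli g).real (X ∩ {ω | e₀ ∉ ω}) := by
    intro X
    rw [← measureReal_inter_add_sdiff (s := X) (MeasurableSet.of_discrete : MeasurableSet {ω : BondConfig (Fin n) | e₀ ∈ ω})
      (h := measure_ne_top _ _)]
    rfl
  -- (i) the part with `e₀` open: up-set exchange
  have hopen : (prodBernoulli g).real ((openConn a b ∩ U) ∩ {ω | e₀ ∈ ω}) ≤
      (prodBernoulli g).real ((⋃ o ∈ O, openConn o b) ∩ {ω | e₀ ∈ ω}) := by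
    have hC : ∀ e ∈ ({e₀} : Finset (Sym2 (Fin n))), ¬ e.IsDiag ∧ ∃ x ∈ e, x ∈ O := by
      intro e he
      rw [Finset.mem_singleton] at he
      subst he
      exact ⟨by rw [he₀, Sym2.mk_isDiag_iff]; exact hsv, s₀, Sym2.mem_mk_left s₀ v, hs₀⟩
    have hx := UpsetExchange.upsetExchange_block w O a b v s₀ hvO hs₀ hO0 {e₀} hC (Finset.mem_singleton_self _) hyp
    have hco : {ω : BondConfig (Fin n) | (↑({e₀} : Finset (Sym2 (Fin n))) : Set (Sym2 (Fin n))) ⊆ ω} = {ω | e₀ ∈ ω} := by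
      ext ω; simp
    rw [hco] at hx
    calc (prodBernoulli g).real ((openConn a b ∩ U) ∩ {ω | e₀ ∈ ω})
        ≤ (prodBernoulli g).real (openConn a b ∩ {ω | e₀ ∈ ω}) :=
          measureReal_mono fun ω ⟨⟨h1, _⟩, h2⟩ => ⟨h1, h2⟩
      _ ≤ (prodBernoulli g).real (openConn s₀ b ∩ {ω | e₀ ∈ ω}) := hx
      _ ≤ (prodBernoulli g).real ((⋃ o ∈ O, openConn o b) ∩ {ω | e₀ ∈ ω}) :=
          measureReal_mono fun ω ⟨h1, h2⟩ => ⟨mem_iUnion₂.2 ⟨s₀, hs₀, h1⟩, h2⟩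
  -- (ii) the part with `e₀` closed: delete `e₀` and apply Theorem 4 for the block
  have hge₀ : g e₀ = w e₀ := by simp only [hg, if_neg he₀int]
  have hg'e₀ : g' e₀ = 0 := by simp only [hg', if_neg he₀int, hw', if_true]
  have hgg' : ∀ f, f ≠ e₀ → g f = g' f := by
    intro f hf
    simp only [hg, hg', hw', if_neg hf]
  have hclosedA := real_inter_notMem_eq g g' e₀ hg'e₀ hgg' (openConn a b ∩ U)
  have hclosedB := real_inter_notMem_eq g g' e₀ hg'e₀ hgg' (⋃ o ∈ O, openConn o b)
  have hT4 : (prodBernoulli g').real (openConn a b ∩ U) ≤ (prodBernoulli g').real (⋃ o ∈ O, openConn o b) := by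
    refine blockThm4_witness w' O A a b hOA haO hbO (fun x hx y hyO hyA => ?_) (fun p hp hport => ?_)
    · simp only [hw']
      split_ifs
      · rfl
      · exact hiso x hx y hyO hyA
    · obtain ⟨o, ho, hwo⟩ := hport
      have hne : s(o, p) ≠ e₀ := fun h => by
        apply hwo; simp only [hw', if_pos h]
      have hwo' : w s(o, p) ≠ 0 := by simpa only [hw', if_neg hne] using hwo
      have hpv : p ≠ v := by
        rintro rfl
        by_cases hos : o = s₀
        · exact hne (by rw [hos])
        · exact hwo' (hv1 o ho hos)
      rw [hkill]
      exact hdom p hp hpv ⟨o, ho, hwo'⟩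
  rw [hsplit (openConn a b ∩ U), hsplit (⋃ o ∈ O, openConn o b), hclosedA, hclosedB]
  have h1g : 0 ≤ 1 - (g e₀ : ℝ) := sub_nonneg.2 (g e₀).2.2
  nlinarith [mul_le_mul_of_nonneg_left hT4 h1g]

end BlockQ9


end

end Summit.CriticalPhenomena.PercolationContinuityZ3.Theorems
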